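import Summits.BirchSwinnertonDyer.BirchSwinnertonDyer.Theorems.TwoAdicConverseBDPSplitPrimeLineRestrictionsFinite
import Summits.BirchSwinnertonDyer.BirchSwinnertonDyer.Theorems.TwoAdicConverseBDPSelmerLowerDivisibilityAtTwoEisensteinDevissageResidual
import Summits.BirchSwinnertonDyer.BirchSwinnertonDyer.Theorems.TwoAdicConverseBDPTrivialCharSplitLineFiniteOfPrintFacts
import Summits.BirchSwinnertonDyer.BirchSwinnertonDyer.Theorems.PrintCf2RubinValueTwoLinePushSpecialisation
import Literature.NumberTheory.EllipticCurves.IwasawaSelmerControlCokerProofs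
import HarnessLib

/-!
# Greenberg 1978 §4 IN THE KERNEL: over the `ℤ_p`-line of an imaginary quadratic field unramified outside ONE split prime,
# the unramified-outside-`v` Iwasawa module of the trivial character is finitely generated and `Λ`-TORSION —
# `greenberg1978_splitPrime_iwasawaModule_finite_torsion_holds : Greenberg1978.splitPrime_iwasawaModule_finite_torsion`

Cell `bsd-2adic`, seat `bsd-2adic-conv-1` GEN 41; helper `--supports stmt-BirchSwinnertonDyer-24728` (crux O2
`BDPSelmerLowerDivisibilityAtTwo`, line `two_variable_gv_squeeze_two` v8: the print binder `hGr` of the GL(1) leaf P4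
`TwoAdicBDPEisensteinDevissage.trivialCharSplitLineFiniteAtTwo_of_twoPrintFacts (hGr) (hOV)` is DISCHARGED; the leaf now rests
on ONE print fact, Oukhaba–Viguié 2016 Thm. 1.2). THEOREMS ONLY (no definition, no named fact, no instance, no `sorry`); net
named-fact debt −1. HONEST FRAMING: a theorem about `ℤ_p`-extensions of imaginary quadratic fields; nothing about any elliptic
curve is asserted; O2 / 19556 / 19218 stay OPEN; BSD is proved for no curve by any of this.

## How (`K` imaginary quadratic, `p = v v̄` split, ANY `p`; `κ` the line unramified outside `v`, `γ` a topological generator)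

* ALGEBRA is the tree's: for any Greenberg–Vatsal dual datum `X` of `S = H¹_{𝓕_nr}(K_∞, M) = KellerYin2024.unrSelmer κ M v̄ ∅`,
  `S^Γ = ker(conj_γ − 1)` finite ⟹ `X` finitely generated (Nakayama) and torsion, `Ch(X) = (H)`, `H(0) ≠ 0` (Greenberg LNM
  1716 Lemma 4.2 + Remark; tree `PrintCf2.LinePush.finite_isTorsion_exists_charIdeal_of_finite_endInvariants_unr`).
* §7 `(ℚ_p/ℤ_p)(𝟙) = trivialCharacterModule K p` is `p`-primary with finite `p^k`- and `N`-torsion.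
* §8 **`finite_endInvariants_conjUnr_trivialCharacterModule`** — `S^Γ` IS FINITE for `M = (ℚ_p/ℤ_p)(𝟙)`: a fixed class is the
  restriction of a class of `H¹(Γ_K, M)` (DESCENT for `p`-primary coefficients, tree `ZpExtension.mem_range_resOfLe_of_conjH1_eq`,
  Greenberg Lemma 3.2), i.e. of a continuous character `χ : Γ_K → M` which is unramified outside `v` (`I_w ≤ Gal(K̄/K_∞)` for
  `w ≠ v`; `exists_character_of_conjH1_eq`); the restrictions of such characters form a finite set by class field theory
  (`finite_setOf_restrict_kerSubgroup`, file `…SplitPrimeLineRestrictionsFinite`), and a class with trivial coefficients is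
  determined by its cocycle.
* §9 the discharge, and `exists_charIdeal_eq_span_constantCoeff_ne_zero` (`H(0) ≠ 0` for every dual datum).

References: [Greenberg1978] §4 (closing Remark, as quoted in [OukhabaViguie2016MuInvariant] p. 1); [GreenbergLNM1716] §3 Lemma 3.2,
§4 Lemma 4.2; [Lang1990] Ch. 5 §5; [Washington1997] §13; [GreenbergVatsal2000] §2; [KellerYin2024] §1.1–1.2.
-/

-- D-0017: single-problem summit, the namespace repeats the problem name by design.
set_option linter.dupNamespace false
set_option autoImplicit false

noncomputable section

open scoped Classical

open NumberField IsDedekindDomain Field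
open Literature.NumberTheory.GaloisRepresentations Literature.NumberTheory.NumberFields
  Literature.NumberTheory.EllipticCurves
open Literature.NumberTheory.EllipticCurves.GreenbergSelmer Literature.NumberTheory.EllipticCurves.GreenbergVatsal2000
  Literature.NumberTheory.EllipticCurves.KellerYin2024 Literature.NumberTheory.IwasawaTheory
  Literature.NumberTheory.EllipticCurves.IwasawaDual

namespace Summit.BirchSwinnertonDyer.BirchSwinnertonDyer.Theorems.TwoAdicBDPSplitPrimeTorsion

variable {K : Type} [Field K] [NumberField K] {p : ℕ} [Fact p.Prime]

/-! ## §7 The trivial character module: torsion, continuity -/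

section TrivChar

/-- `(ℚ_p/ℤ_p)(𝟙)` is `p`-primary (tree `GreenbergSelmer.exists_pow_smul_cofree_eq_zero`; private restatement).
[cite: KellerYin2024, §1.1 (arXiv:2402.12781v2 TeX L441–449)] -/
private theorem exists_pow_smul_trivialCharacterModule_eq_zero (m : trivialCharacterModule K p) :
    ∃ k : ℕ, p ^ k • m = 0 :=
  GreenbergSelmer.exists_pow_smul_cofree_eq_zero _ _ m

/-- Finite `p^k`-torsion of `(ℚ_p/ℤ_p)(𝟙)` for every `k` (induction on `k` from the finite `p`-torsion, tree
`TwoAdicBDPTrivialCharLine.finite_pTorsion_trivialCharacterModule`, by the counting dévissage along `m ↦ p • m`).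
[cite: KellerYin2024, §1.1 (arXiv:2402.12781v2 TeX L441–449)] -/
theorem finite_powTorsion_trivialCharacterModule (k : ℕ) :
    Set.Finite {m : trivialCharacterModule K p | p ^ k • m = 0} := by
  induction k with
  | zero =>
    refine (Set.finite_singleton (0 : trivialCharacterModule K p)).subset fun m hm ↦ ?_
    simpa using hm
  | succ k ih =>
    have h1 := TwoAdicBDPTrivialCharLine.finite_pTorsion_trivialCharacterModule K p
    refine TwoAdicBDPTrivialCharLine.finite_of_finite_image_of_finite_sub
      (DistribSMul.toAddMonoidHom (trivialCharacterModule K p) p) (S := {m | p ^ (k + 1) • m = 0})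
      (F₀ := {m | p • m = 0}) (fun a ha b hb ↦ ?_) ((ih.subset ?_)) h1 (fun a _ ha0 ↦ ha0)
    · change p ^ (k + 1) • (a - b) = 0
      rw [smul_sub, show p ^ (k + 1) • a = 0 from ha, show p ^ (k + 1) • b = 0 from hb, sub_zero]
    · rintro _ ⟨m, hm, rfl⟩
      change p ^ k • (p • m) = 0
      rw [← mul_smul, ← pow_succ]
      exact hm

/-- Finite `N`-torsion of `Multiplicative (ℚ_p/ℤ_p)(𝟙)` for every `N ≥ 1` (an `N`-torsion element of a `p`-primary group
is `p^N`-torsion). [cite: KellerYin2024, §1.1 (arXiv:2402.12781v2 TeX L441–449)] -/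
theorem finite_setOf_pow_eq_one_trivialCharacterModule (N : ℕ) (hN : 0 < N) :
    Set.Finite {b : Multiplicative (trivialCharacterModule K p) | b ^ N = 1} := by
  have hfin := (finite_powTorsion_trivialCharacterModule (K := K) (p := p) N).preimage
    (Multiplicative.toAdd.injective.injOn)
  refine hfin.subset fun b hb ↦ ?_
  change p ^ N • Multiplicative.toAdd b = 0
  have hb' : N • Multiplicative.toAdd b = 0 := by
    rw [← toAdd_pow, show b ^ N = 1 from hb, toAdd_one]
  obtain ⟨k, hk⟩ := exists_pow_smul_trivialCharacterModule_eq_zero (Multiplicative.toAdd b)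
  -- the order divides `gcd(N, p^k)`, which divides `p^N`
  have hdvd : addOrderOf (Multiplicative.toAdd b) ∣ Nat.gcd N (p ^ k) :=
    Nat.dvd_gcd (addOrderOf_dvd_of_nsmul_eq_zero hb') (addOrderOf_dvd_of_nsmul_eq_zero hk)
  have hgcd : Nat.gcd N (p ^ k) ∣ p ^ N := by
    have h1 : Nat.gcd N (p ^ k) ∣ p ^ k := Nat.gcd_dvd_right _ _
    obtain ⟨j, hj, hjeq⟩ := (Nat.dvd_prime_pow (Fact.out : p.Prime)).mp h1
    rw [hjeq]
    refine pow_dvd_pow p ?_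
    have h2 : p ^ j ∣ N := hjeq ▸ Nat.gcd_dvd_left _ _
    have h3 : p ^ j ≤ N := Nat.le_of_dvd hN h2
    exact le_trans (Nat.lt_pow_self (Fact.out : p.Prime).one_lt).le h3
  exact addOrderOf_dvd_iff_nsmul_eq_zero.mp (hdvd.trans hgcd)

end TrivChar

/-! ## §8 The `Γ`-invariants of `H¹_{nr outside v}(K_∞, ℚ_p/ℤ_p)` are FINITE -/

section Invariants

/-- The Galois action on `(ℚ_p/ℤ_p)(𝟙)` is trivial (tree `TwoAdicBDPTrivialCharLine.smul_trivialCharacterModule`, restated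
for the section). [cite: KellerYin2024, §1.1 (arXiv:2402.12781v2 TeX L441–449)] -/
private theorem htriv' (σ : absoluteGaloisGroup K) (m : trivialCharacterModule K p) : σ • m = m :=
  TwoAdicBDPTrivialCharLine.smul_trivialCharacterModule σ m

omit [NumberField K] in
/-- Every element of `Γ_K` lies in the zeroth layer subgroup `κ⁻¹(p⁰ℤ_p)`. [cite: Washington1997, §13.1] -/
private theorem mem_layerSubgroup_zero' (κ : ZpExtension K p) (g : absoluteGaloisGroup K) : g ∈ κ.layerSubgroup 0 :=
  ZpExtension.mem_layerSubgroup.mpr (by rw [pow_zero]; exact one_dvd _)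

/-- **The cocycle of an unramified class dies on `Gal(K̄/K_∞) ∩ I_w` for every `w ≠ v`** (`K` quadratic, `p = v v̄`): at
`w ∤ p` this is the unramified condition of `unrSelmer`, at `w = v̄` Greenberg's inertia condition for the strict datum
(tree `TwoAdicBDPEisensteinDevissage.mem_datumSelmer_bdpData_iff`, conjugate `σ = 1`), read on the (unique) cocycle of the
class (trivial action). [cite: GreenbergVatsal2000, §2 pp. 16–17, 20] [cite: Greenberg1989, §1 p. 98 (4)] -/
theorem cocycle_apply_eq_zero_of_mem_unrSelmer_of_mem_inertia (hK2 : Module.finrank ℚ K = 2)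
    {v vbar : HeightOneSpectrum (𝓞 K)} (hv : ((p : ℕ) : 𝓞 K) ∈ v.asIdeal)
    (hvbar : ((p : ℕ) : 𝓞 K) ∈ vbar.asIdeal) (hne : vbar ≠ v) (κ : ZpExtension K p)
    {c : contOneCocycles (discreteTopRep κ.kerSubgroup (trivialCharacterModule K p))}
    (hc : oneCocycleClass _ c ∈ unrSelmer κ (trivialCharacterModule K p) vbar ∅)
    {w : HeightOneSpectrum (𝓞 K)} (hw : w ≠ v) {i : absoluteGaloisGroup K} (hiN : i ∈ κ.kerSubgroup)
    (hiI : i ∈ GreenbergSelmer.inertia w) : c.1 ⟨i, hiN⟩ = 0 := by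
  have hmem := (TwoAdicBDPEisensteinDevissage.mem_datumSelmer_bdpData_iff κ.kerSubgroup p
    (∅ : Set (HeightOneSpectrum (𝓞 K))) hvbar (oneCocycleClass _ c)).mp hc
  have hres : resOfLe (trivialCharacterModule K p)
      (inf_le_left : κ.kerSubgroup ⊓ GreenbergSelmer.inertia w ≤ κ.kerSubgroup) (oneCocycleClass _ c) = 0 := by
    by_cases hpw : ((p : ℕ) : 𝓞 K) ∈ w.asIdeal
    · rcases ZpExtension.eq_or_eq_of_natCast_mem_of_finrank_eq_two hK2 hv hvbar hne hpw with h | h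
      · exact absurd h hw
      · subst h
        have h1 := hmem.2 1
        rwa [Literature.NumberTheory.EllipticCurves.conjH1_one_holds κ.kerSubgroup (trivialCharacterModule K p),
          AddMonoidHom.id_apply] at h1
    · have h1 := hmem.1 w (Set.notMem_empty w) hpw 1
      rwa [Literature.NumberTheory.EllipticCurves.conjH1_one_holds κ.kerSubgroup (trivialCharacterModule K p),
        AddMonoidHom.id_apply] at h1
  rw [TwoAdicGreenbergCotorsion.resOfLe_oneCocycleClass_eq_zero_iff_of_trivial htriv'] at hres
  exact hres ⟨i, Subgroup.mem_inf.mpr ⟨hiN, hiI⟩⟩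

/-- **DESCENT + TRANSFER.** A class of `H¹_{nr outside v}(K_∞, (ℚ_p/ℤ_p)(𝟙))` fixed by `conj_γ` (`γ` a topological
generator of the line `κ`, unramified outside the split place `v`) is the restriction of a continuous character
`χ : Γ_K → (ℚ_p/ℤ_p)(𝟙)` UNRAMIFIED OUTSIDE `v` (`I_w ≤ ker χ` for the chosen inertia groups, `w ≠ v`): descend the class
(tree `ZpExtension.mem_range_resOfLe_of_conjH1_eq`, Greenberg's Lemma 3.2 for `p`-primary coefficients), read the descended
class as a homomorphism (trivial action), and note `I_w ≤ Gal(K̄/K_∞)` for `w ≠ v` (the line is unramified there), where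
the cocycle dies (`cocycle_apply_eq_zero_of_mem_unrSelmer_of_mem_inertia`). [cite: GreenbergLNM1716, §3 Lemma 3.2]
[cite: Greenberg1978, §4] -/
theorem exists_character_of_conjH1_eq (hK2 : Module.finrank ℚ K = 2)
    {v vbar : HeightOneSpectrum (𝓞 K)} (hv : ((p : ℕ) : 𝓞 K) ∈ v.asIdeal)
    (hvbar : ((p : ℕ) : 𝓞 K) ∈ vbar.asIdeal) (hne : vbar ≠ v) (κ : ZpExtension K p)
    (hκ : κ.IsUnramifiedOutside v) {γ : absoluteGaloisGroup K} (hγ : κ.IsTopGenerator γ)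
    {c : contOneCocycles (discreteTopRep κ.kerSubgroup (trivialCharacterModule K p))}
    (hc : oneCocycleClass _ c ∈ unrSelmer κ (trivialCharacterModule K p) vbar ∅)
    (hfix : conjH1 κ.kerSubgroup (trivialCharacterModule K p) γ (oneCocycleClass _ c) = oneCocycleClass _ c) :
    ∃ χ : absoluteGaloisGroup K →ₜ* Multiplicative (trivialCharacterModule K p),
      (∀ w : HeightOneSpectrum (𝓞 K), w ≠ v →
        GreenbergSelmer.inertia w ≤ (χ : absoluteGaloisGroup K →* Multiplicative (trivialCharacterModule K p)).ker) ∧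
      ∀ g : κ.kerSubgroup, χ (g : absoluteGaloisGroup K) = Multiplicative.ofAdd (c.1 g) := by
  have hprim : ∀ m : trivialCharacterModule K p, ∃ k : ℕ, p ^ k • m = 0 :=
    exists_pow_smul_trivialCharacterModule_eq_zero
  have hcont : ∀ m : trivialCharacterModule K p, Continuous fun g : absoluteGaloisGroup K ↦ g • m := fun m ↦ by
    have : (fun g : absoluteGaloisGroup K ↦ g • m) = fun _ ↦ m := funext fun g ↦ htriv' g m
    rw [this]; exact continuous_const
  -- descent to `Γ_K`
  have hfix' : conjH1 κ.kerSubgroup (trivialCharacterModule K p) (γ ^ p ^ 0) (oneCocycleClass _ c) =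
      oneCocycleClass _ c := by rw [pow_zero, pow_one]; exact hfix
  obtain ⟨y, hy⟩ := (AddMonoidHom.mem_range).mp
    (ZpExtension.mem_range_resOfLe_of_conjH1_eq κ hγ 0 hcont hprim (oneCocycleClass _ c) hfix')
  obtain ⟨zy, rfl⟩ := oneCocycleClass_surjective _ y
  -- the two cocycles agree on `ker κ`
  have hcl : oneCocycleClass _ c = oneCocycleClass _
      (contOneCocycles.pullback (subgroupInclusion (κ.kerSubgroup_le_layerSubgroup 0))
        (resHomOfEquivariant (subgroupInclusion (κ.kerSubgroup_le_layerSubgroup 0))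
          (AddMonoidHom.id (trivialCharacterModule K p)) (fun _ _ ↦ rfl)) zy) := by
    rw [← hy, resOfLe]
    exact TwoAdicGreenbergCotorsion.resH1Hom_id_oneCocycleClass_eq _ _ _ zy
  have heq := TwoAdicBDPTrivialCharLine.cocycle_eq_of_oneCocycleClass_eq κ.kerSubgroup htriv' hcl
  have hzz : ∀ g : κ.kerSubgroup, c.1 g = zy.1 ⟨(g : absoluteGaloisGroup K), mem_layerSubgroup_zero' κ g⟩ := by
    intro g
    have e := congrArg (fun d : contOneCocycles (discreteTopRep κ.kerSubgroup (trivialCharacterModule K p)) ↦ d.1 g) heq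
    exact e
  -- the character `g ↦ zy(g)`
  obtain ⟨χ, hχ⟩ : ∃ χ : absoluteGaloisGroup K →ₜ* Multiplicative (trivialCharacterModule K p),
      ∀ g : absoluteGaloisGroup K, χ g = Multiplicative.ofAdd (zy.1 ⟨g, mem_layerSubgroup_zero' κ g⟩) :=
    ⟨{ toFun := fun g ↦ Multiplicative.ofAdd (zy.1 ⟨g, mem_layerSubgroup_zero' κ g⟩)
       map_one' := by
         rw [← ofAdd_zero]
         exact congrArg _ (TwoAdicGreenbergCotorsion.cocycle_one_of_trivial htriv' zy)
       map_mul' := fun g h ↦ by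
         rw [← ofAdd_add]
         exact congrArg _ (TwoAdicGreenbergCotorsion.cocycle_mul_of_trivial htriv' zy
           ⟨g, mem_layerSubgroup_zero' κ g⟩ ⟨h, mem_layerSubgroup_zero' κ h⟩)
       continuous_toFun :=
         continuous_ofAdd.comp (zy.1.continuous.comp (Continuous.subtype_mk continuous_id _)) },
      fun _ ↦ rfl⟩
  refine ⟨χ, fun w hw i hi ↦ ?_, fun g ↦ by rw [hχ, hzz g]⟩
  have hiN : i ∈ κ.kerSubgroup := (ZpExtension.isUnramifiedOutside_iff κ v).mp hκ w hw hi
  rw [MonoidHom.mem_ker]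
  change χ i = 1
  rw [hχ, ← ofAdd_zero]
  refine congrArg _ ?_
  rw [← hzz ⟨i, hiN⟩]
  exact cocycle_apply_eq_zero_of_mem_unrSelmer_of_mem_inertia hK2 hv hvbar hne κ hc hw hiN hi

/-- **`S^Γ` is finite.** `K` imaginary quadratic, `p = v v̄` split, `κ` the `ℤ_p`-line unramified outside `v`, `γ` a
topological generator, `A = (ℚ_p/ℤ_p)(𝟙)`: the subgroup of `conj_γ`-fixed classes of
`H¹_{𝓕_nr}(K_∞, A) = KellerYin2024.unrSelmer κ A v̄ ∅` (unramified at every `w ∤ p` and above `v̄`, nothing above `v`) is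
finite: a fixed class is determined by its cocycle on `Gal(K̄/K_∞)` (trivial action), which is the restriction of a character
of `Γ_K` unramified outside `v` (`exists_character_of_conjH1_eq`), and those restrictions form a finite set
(`finite_setOf_restrict_kerSubgroup`, class field theory). [cite: Greenberg1978, §4] [cite: GreenbergLNM1716, §3 Lemma 3.2]
[cite: Lang1990, Ch. 5 §5, Thm. 5.1] -/
theorem finite_endInvariants_conjUnr_trivialCharacterModule (hK : IsImaginaryQuadratic K)
    {v vbar : HeightOneSpectrum (𝓞 K)} (hv : ((p : ℕ) : 𝓞 K) ∈ v.asIdeal)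
    (hvbar : ((p : ℕ) : 𝓞 K) ∈ vbar.asIdeal) (hne : vbar ≠ v) (κ : ZpExtension K p)
    (hκ : κ.IsUnramifiedOutside v) {γ : absoluteGaloisGroup K} (hγ : κ.IsTopGenerator γ) :
    Finite (endInvariants (conjUnr κ (trivialCharacterModule K p) vbar ∅ γ - 1)) := by
  classical
  -- the finite target set of restrictions (CFT count)
  have hfin := finite_setOf_restrict_kerSubgroup hK hv hvbar hne κ hκ
    (B := Multiplicative (trivialCharacterModule K p))
    (fun N hN ↦ finite_setOf_pow_eq_one_trivialCharacterModule N hN)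
  set T : Set (κ.kerSubgroup → Multiplicative (trivialCharacterModule K p)) :=
    {f | ∃ χ : absoluteGaloisGroup K →ₜ* Multiplicative (trivialCharacterModule K p),
      (∀ w : HeightOneSpectrum (𝓞 K), w ≠ v →
        GreenbergSelmer.inertia w ≤ (χ : absoluteGaloisGroup K →* Multiplicative (trivialCharacterModule K p)).ker) ∧
      f = fun g : κ.kerSubgroup ↦ χ (g : absoluteGaloisGroup K)} with hT
  haveI : Finite T := hfin.to_subtype
  set I := endInvariants (conjUnr κ (trivialCharacterModule K p) vbar ∅ γ - 1) with hI
  -- the cocycle of a fixed class and its value function on `Gal(K̄/K_∞)`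
  have hz : ∀ s : I, ∃ c : contOneCocycles (discreteTopRep κ.kerSubgroup (trivialCharacterModule K p)),
      oneCocycleClass _ c = ((s : unrSelmer κ (trivialCharacterModule K p) vbar ∅) :
        subgroupH1 κ.kerSubgroup (trivialCharacterModule K p)) := fun s ↦
    oneCocycleClass_surjective _ _
  choose z hz using hz
  have hΘ : ∀ s : I, (fun g : κ.kerSubgroup ↦ Multiplicative.ofAdd ((z s).1 g)) ∈ T := by
    intro s
    have hs : conjH1 κ.kerSubgroup (trivialCharacterModule K p) γ (oneCocycleClass _ (z s)) =
        oneCocycleClass _ (z s) := by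
      have h := s.2
      rw [mem_endInvariants_iff, IwasawaDual.End_sub_apply, AddMonoid.End.one_apply, sub_eq_zero] at h
      have h' := congrArg (fun t : unrSelmer κ (trivialCharacterModule K p) vbar ∅ ↦
        (t : subgroupH1 κ.kerSubgroup (trivialCharacterModule K p))) h
      rw [hz s]
      exact h'
    have hc : oneCocycleClass _ (z s) ∈ unrSelmer κ (trivialCharacterModule K p) vbar ∅ := by
      rw [hz s]; exact (s : unrSelmer κ (trivialCharacterModule K p) vbar ∅).2
    obtain ⟨χ, hχ, hχz⟩ := exists_character_of_conjH1_eq hK.1 hv hvbar hne κ hκ hγ hc hs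
    exact ⟨χ, hχ, funext fun g ↦ (hχz g).symm⟩
  refine Finite.of_injective (fun s : I ↦ (⟨_, hΘ s⟩ : T)) fun s s' h ↦ ?_
  have h1 : (fun g : κ.kerSubgroup ↦ Multiplicative.ofAdd ((z s).1 g)) =
      fun g : κ.kerSubgroup ↦ Multiplicative.ofAdd ((z s').1 g) := congrArg Subtype.val h
  have hzz : z s = z s' := by
    apply Subtype.ext
    ext g
    exact Multiplicative.ofAdd.injective (congrFun h1 g)
  apply Subtype.ext; apply Subtype.ext
  rw [← hz s, ← hz s', hzz]

end Invariants

/-! ## §9 Greenberg 1978 §4 in the kernel: `X_∞` is a finitely generated torsion `Λ`-module -/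

section Greenberg

/-- **DISCHARGE of the named fact `Greenberg1978.splitPrime_iwasawaModule_finite_torsion` (Greenberg 1978, §4, closing
Remark: over the `ℤ_p`-extension of an imaginary quadratic field unramified outside ONE split prime `v`, the `v`-ramified
Iwasawa module `X_∞ = Gal(M_∞/K_∞)` of the trivial character is a finitely generated TORSION `Λ`-module), ALL primes `p`.**
Proof in the tree's currency: ANY Greenberg–Vatsal dual datum `X` of `H¹_{nr outside v}(K_∞, (ℚ_p/ℤ_p)(𝟙))` is a Pontryagin
dual pair for `ψ = conj_γ − 1` and `S^Γ = ker ψ` is FINITE (`finite_endInvariants_conjUnr_trivialCharacterModule`: descent +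
class field theory), whence `X` is finitely generated (Nakayama) and torsion (`N X ⊆ T X`), Greenberg LNM 1716 Lemma 4.2 +
Remark — tree `PrintCf2.LinePush.finite_isTorsion_exists_charIdeal_of_finite_endInvariants_unr`. Net named-fact debt −1; the
print binder `hGr` of the O2 line `two_variable_gv_squeeze_two` (P4 `trivialCharSplitLineFiniteAtTwo_of_twoPrintFacts hGr hOV`) is a
theorem. [cite: Greenberg1978, §4 (closing Remark; quoted in OukhabaViguie2016MuInvariant p. 1 L24–27)]
[cite: GreenbergLNM1716, §4 Lemma 4.2 (Remark, p. 103)] [cite: Lang1990, Ch. 5 §5, Thm. 5.1] -/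
theorem greenberg1978_splitPrime_iwasawaModule_finite_torsion_holds :
    Greenberg1978.splitPrime_iwasawaModule_finite_torsion := by
  intro K _ _ hK p _ v vbar hv hvbar hne κ hκ γ hγ X
  have htor : ∀ m : trivialCharacterModule K p, ∃ k : ℕ, p ^ k • m = 0 :=
    exists_pow_smul_trivialCharacterModule_eq_zero
  have hstab : ∀ m : trivialCharacterModule K p,
      IsOpen (MulAction.stabilizer (absoluteGaloisGroup K) m : Set (absoluteGaloisGroup K)) := fun m ↦ by
    have h : (MulAction.stabilizer (absoluteGaloisGroup K) m : Set (absoluteGaloisGroup K)) = Set.univ :=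
      Set.eq_univ_of_forall fun g ↦ MulAction.mem_stabilizer_iff.mpr (htriv' g m)
    rw [h]
    exact isOpen_univ
  have h := PrintCf2.LinePush.finite_isTorsion_exists_charIdeal_of_finite_endInvariants_unr X htor hstab hγ
    (finite_endInvariants_conjUnr_trivialCharacterModule hK hv hvbar hne κ hκ hγ)
  exact ⟨h.1, h.2.1⟩

/-- **… and its characteristic power series has NON-ZERO constant term** (`Ch_Λ(X) = (H)`, `H(0) ≠ 0`: Greenberg's Lemma 4.2,
since `S^Γ` is finite), i.e. `X_∞/T X_∞` and `X_∞[T]` are finite — for every dual datum, every `p`.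
[cite: GreenbergLNM1716, §4 Lemma 4.2 (p. 102)] [cite: Greenberg1978, §4] -/
theorem exists_charIdeal_eq_span_constantCoeff_ne_zero (hK : IsImaginaryQuadratic K)
    {v vbar : HeightOneSpectrum (𝓞 K)} (hv : ((p : ℕ) : 𝓞 K) ∈ v.asIdeal)
    (hvbar : ((p : ℕ) : 𝓞 K) ∈ vbar.asIdeal) (hne : vbar ≠ v) (κ : ZpExtension K p)
    (hκ : κ.IsUnramifiedOutside v) {γ : absoluteGaloisGroup K} (hγ : κ.IsTopGenerator γ)
    (X : DatumDualData κ γ (trivialCharacterModule K p)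
      (Castella2018.AcSelmer.bdpData (trivialCharacterModule K p) p vbar) ∅) :
    Module.Finite (IwasawaAlgebra p) X.X ∧ Module.IsTorsion (IwasawaAlgebra p) X.X ∧
      ∃ H : IwasawaAlgebra p, Module.charIdeal (IwasawaAlgebra p) X.X = Ideal.span {H} ∧
        PowerSeries.constantCoeff H ≠ 0 := by
  have htor : ∀ m : trivialCharacterModule K p, ∃ k : ℕ, p ^ k • m = 0 :=
    exists_pow_smul_trivialCharacterModule_eq_zero
  have hstab : ∀ m : trivialCharacterModule K p,
      IsOpen (MulAction.stabilizer (absoluteGaloisGroup K) m : Set (absoluteGaloisGroup K)) := fun m ↦ by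
    have h : (MulAction.stabilizer (absoluteGaloisGroup K) m : Set (absoluteGaloisGroup K)) = Set.univ :=
      Set.eq_univ_of_forall fun g ↦ MulAction.mem_stabilizer_iff.mpr (htriv' g m)
    rw [h]
    exact isOpen_univ
  exact PrintCf2.LinePush.finite_isTorsion_exists_charIdeal_of_finite_endInvariants_unr X htor hstab hγ
    (finite_endInvariants_conjUnr_trivialCharacterModule hK hv hvbar hne κ hκ hγ)

end Greenberg

end Summit.BirchSwinnertonDyer.BirchSwinnertonDyer.Theorems.TwoAdicBDPSplitPrimeTorsion

end
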